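import Literature.NumberTheory.Automorphic.ModularFormAlgebraicLambda
import Literature.NumberTheory.ModularForms.QExpansionAlgebra
import Literature.LinearAlgebra.BaseChange.LinearIndependentFieldExtension
import Literature.RingTheory.PowerSeries.RootCoefficientField
import HarnessLib

/-!
# Modular forms with `q`-coefficients in a field `K ⊆ ℂ` are algebraic over `K(λ)`

Eleventh file on the modular `λ`-function. In `ModularFormAlgebraicLambda.lean` a modular form
`f` of even weight `2k` for a finite-index `Γ ≤ SL(2, ℤ)` was shown to satisfy
`Σ_{n ≤ d} A_n(λ) (f/θ₃^{4k})ⁿ = 0` with `A_n ∈ ℂ[X]`, `A_d ≠ 0`. Here the coefficients are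
DESCENDED: if the `q`-expansion of `f` at a strict period `h` of `Γ` has all its coefficients in a
subfield `K ⊆ ℂ`, the polynomials `A_n` may be taken in `K[X]` (not all zero) —
`exists_polynomial_relation_modularForm_of_coeff_mem`. This is the form in which
Calegari–Dimitrov–Tang use "`f` is an algebraic function of `λ`" (F. Calegari, V. Dimitrov,
Y. Tang, *The unbounded denominators conjecture*, J. Amer. Math. Soc. **38** (2025),
arXiv:2109.09040, §1 p. 3, §3): for `f ∈ ℤ⟦q^{1/N}⟧` (or `ℚ̄`-coefficients) the algebraic relation
is defined over `ℚ` (or `ℚ̄`).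

Proof. Write the relation with denominators cleared,
`Σ_{n ≤ d, j ≤ N} c_{n,j} λʲ θ₃^{4k(d−n)} fⁿ = 0`,
as a `ℂ`-linear relation among the functions `G_{n,j} = λʲ θ₃^{4k(d−n)} fⁿ`. Each `G_{n,j}` is
holomorphic on `ℍ`, `2h`-periodic and bounded at `i∞`, so it is the sum of its `q`-expansion in
`q = e^{2πiτ/(2h)}` (Mathlib's `hasSum_qExpansion`), whose coefficients lie in `K`:
`qExpansion` is multiplicative on such functions (Mathlib's `qExpansion_mul`), the expansions of
`λ = 16q^{h} − 128q^{2h} + ⋯` and `θ₃ = 1 + 2q^{h} + ⋯` have integer coefficients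
(`ModularLambdaQExpansion.lean`) and that of `f` has coefficients in `K` (re-indexed from the
period `h` to `2h`). Uniqueness of `q`-expansions turns the relation into the vanishing of all
coefficients of `Σ c_{n,j} · qExpansion(G_{n,j})`, a linear system with matrix entries in `K`
having a non-trivial complex solution; by
`Literature.LinearAlgebra.BaseChange.exists_ne_zero_linearRelation_of_algebraMap` it has a
non-trivial solution in `K`, which is the descended relation.

Besides the theorem the file provides the re-indexing lemma `hasSum_smul_qParam_natMul`
(`Σ aₘ 𝕢_H(τ)ᵐ = Σ a'ₘ 𝕢_{nH}(τ)ᵐ` with `a'_{nm} = aₘ`, `a' = 0` off the multiples of `n`) and the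
`q`-expansions of `λ` and `θ₃` at every period `2h` (`exists_coeff_qExpansion_modularLambda_eq`,
`exists_coeff_qExpansion_theta3_eq`, `coeff_qExpansion_modularLambda_mem`,
`coeff_qExpansion_theta3_mem`: integers), and the passage from the period `h` to `2h` for modular
forms (`nice_modularForm`, `coeff_qExpansion_two_mul_eq`, `coeff_qExpansion_two_mul_mem`).

## References

* [CalegariDimitrovTang2025] F. Calegari, V. Dimitrov, Y. Tang, J. Amer. Math. Soc. 38 (2025),
  arXiv:2109.09040, §1 p. 3 and §3 (algebraicity of `f` over `ℚ̄(λ)`).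
-/

noncomputable section

open Complex Filter Topology Function Set Polynomial
open UpperHalfPlane hiding I
open scoped Real Topology MatrixGroups ModularForm Manifold

namespace Literature.NumberTheory.Automorphic

namespace ModularLambda

open Literature.NumberTheory.EllipticCurves.JacobiThetaNull
open Literature.RingTheory.PowerSeries (coeff_mul_mem coeff_pow_mem)
open ModularGroup Matrix.SpecialLinearGroup
open Literature.NumberTheory.ModularForms.QExpansionAlgebra

/-! ### Periodic holomorphic functions bounded at `i∞` ("nice" functions) -/

/-- The restriction to `ℍ` of a function with `g(z + T) = g(z)` on `ℍ` is `T`-periodic in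
Mathlib's sense. [folklore] -/
theorem periodic_comp_ofComplex_of_forall {g : ℂ → ℂ} {T : ℝ}
    (hp : ∀ z : ℂ, 0 < z.im → g (z + T) = g z) :
    Periodic ((fun τ : ℍ ↦ g τ) ∘ ofComplex) T := by
  intro w
  by_cases hw : 0 < im w
  · have hw' : 0 < im (w + (T : ℂ)) := by simpa using hw
    rw [comp_ofComplex_of_im_pos _ _ hw', comp_ofComplex_of_im_pos _ _ hw]
    exact hp w hw
  · have hw0 : im w ≤ 0 := not_lt.mp hw
    have hw' : im (w + (T : ℂ)) ≤ 0 := by simpa using hw0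
    exact comp_ofComplex_of_im_le_zero _ _ _ hw' hw0

/-! ### Re-indexing `q`-series from the period `H` to the period `nH` -/

/-- Coefficients of a re-indexed expansion: if `F` is `nH`-periodic, holomorphic and bounded at
`i∞` and `F(τ) = Σ aₘ 𝕢_H(τ)ᵐ` on `ℍ`, then the `m`-th coefficient of `qExpansion (nH) F` is
`a_{m/n}` for `n ∣ m` and `0` otherwise. [folklore] -/
theorem qExpansion_natMul_coeff_of_hasSum {F : ℍ → ℂ} {H H' : ℝ} {n : ℕ} (hn : n ≠ 0) (hHH' : H' = n * H)
    (hH' : 0 < H') (hF : Periodic (F ∘ ofComplex) H' ∧ MDiff F ∧ IsBoundedAtImInfty F)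
    {a : ℕ → ℂ} (ha : ∀ τ : ℍ, HasSum (fun m ↦ a m • Periodic.qParam H τ ^ m) (F τ)) (m : ℕ) :
    (qExpansion H' F).coeff m = if n ∣ m then a (m / n) else 0 := by
  subst hHH'
  exact qExpansion_coeff_eq_of_hasSum hH' (analyticAt_cuspFunction_zero hH' hF.1 hF.2.1 hF.2.2)
    (fun τ ↦ hasSum_smul_qParam_natMul hn (ha τ)) m

/-! ### `λ` and `θ₃` at the period `2h` -/

/-- `λ` restricted to `ℍ` is `2h`-periodic, holomorphic and bounded at `i∞`. [folklore] -/
theorem nice_modularLambda (h : ℕ) :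
    Periodic ((fun τ : ℍ ↦ modularLambda τ) ∘ ofComplex) (((h : ℝ) * 2 : ℝ) : ℂ) ∧
      MDiff (fun τ : ℍ ↦ modularLambda τ) ∧ IsBoundedAtImInfty (fun τ : ℍ ↦ modularLambda τ) := by
  refine ⟨?_, mdifferentiable_of_differentiableAt fun z hz ↦ differentiableAt_modularLambda hz,
    isBoundedAtImInfty_of_tendsto tendsto_modularLambda⟩
  have hp : Periodic ((fun τ : ℍ ↦ modularLambda τ) ∘ ofComplex) ((2 : ℝ) : ℂ) :=
    periodic_comp_ofComplex_of_forall fun z _ ↦ by exact_mod_cast modularLambda_add_two z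
  have e : (((h : ℝ) * 2 : ℝ) : ℂ) = (h : ℕ) * ((2 : ℝ) : ℂ) := by push_cast; ring
  rw [e]
  exact hp.nat_mul h

/-- `θ₃(z + 2) = θ₃(z)`. [folklore] -/
theorem theta3_add_two (z : ℂ) : theta3 (z + 2) = theta3 z := by
  rw [show z + 2 = z + 1 + 1 by ring, theta3_add_one, theta4_add_one]

/-- `θ₃` restricted to `ℍ` is `2h`-periodic, holomorphic and bounded at `i∞`. [folklore] -/
theorem nice_theta3 (h : ℕ) :
    Periodic ((fun τ : ℍ ↦ theta3 τ) ∘ ofComplex) (((h : ℝ) * 2 : ℝ) : ℂ) ∧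
      MDiff (fun τ : ℍ ↦ theta3 τ) ∧ IsBoundedAtImInfty (fun τ : ℍ ↦ theta3 τ) := by
  refine ⟨?_, mdifferentiable_of_differentiableAt fun z hz ↦ differentiableAt_theta3 hz,
    isBoundedAtImInfty_of_tendsto tendsto_theta3⟩
  have hp : Periodic ((fun τ : ℍ ↦ theta3 τ) ∘ ofComplex) ((2 : ℝ) : ℂ) :=
    periodic_comp_ofComplex_of_forall fun z _ ↦ by exact_mod_cast theta3_add_two z
  have e : (((h : ℝ) * 2 : ℝ) : ℂ) = (h : ℕ) * ((2 : ℝ) : ℂ) := by push_cast; ring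
  rw [e]
  exact hp.nat_mul h

/-- **The `q`-expansion of `λ` at the period `2h` has integer coefficients** (`λ = 16 Σ Lₘ qʰᵐ`
with `L ∈ ℤ⟦X⟧` the series of `ModularLambdaQExpansion.lean`): the `m`-th coefficient is
`16 L_{m/h}` for `h ∣ m` and `0` otherwise, `L₀ = 0`, `L₁ = 1`.
[cite: CalegariDimitrovTang2025, §1 p. 3 (`λ/16 = q − 8q² + ⋯ ∈ ℤ⟦q⟧`)] -/
theorem exists_coeff_qExpansion_modularLambda_eq {h : ℕ} (hh : 0 < h) :
    ∃ L : PowerSeries ℤ, PowerSeries.coeff 0 L = 0 ∧ PowerSeries.coeff 1 L = 1 ∧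
      ∀ m, (qExpansion ((h : ℝ) * 2) (fun τ : ℍ ↦ modularLambda τ)).coeff m =
        if h ∣ m then 16 * ((PowerSeries.coeff (m / h) L : ℤ) : ℂ) else 0 := by
  obtain ⟨L, hL0, hL1, -, hL⟩ := exists_hasSum_modularLambda_div_sixteen
  have ha : ∀ τ : ℍ, HasSum (fun m ↦ (16 * ((PowerSeries.coeff m L : ℤ) : ℂ)) •
      Periodic.qParam 2 τ ^ m) (modularLambda τ) := by
    intro τ
    have := (hL τ τ.im_pos).mul_left 16
    rw [mul_div_cancel₀ _ (by norm_num : (16 : ℂ) ≠ 0)] at this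
    simpa only [smul_eq_mul, mul_assoc, qParam_two] using this
  exact ⟨L, hL0, hL1, fun m ↦
    qExpansion_natMul_coeff_of_hasSum hh.ne' (by ring) (by positivity) (nice_modularLambda h) ha m⟩

/-- The `q`-expansion of `λ` at the period `2h` has integer coefficients.
[cite: CalegariDimitrovTang2025, §1 p. 3] -/
theorem coeff_qExpansion_modularLambda_mem {h : ℕ} (hh : 0 < h) (m : ℕ) :
    ∃ z : ℤ, (qExpansion ((h : ℝ) * 2) (fun τ : ℍ ↦ modularLambda τ)).coeff m = z := by
  obtain ⟨L, -, -, hL⟩ := exists_coeff_qExpansion_modularLambda_eq hh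
  rw [hL m]
  split_ifs
  · exact ⟨16 * PowerSeries.coeff (m / h) L, by push_cast; rfl⟩
  · exact ⟨0, by simp⟩

/-- **The `q`-expansion of `θ₃` at the period `2h`**: the `m`-th coefficient is `a_{m/h} ∈ ℤ`
for `h ∣ m` (`a₀ = 1`, `a₁ = 2`, the coefficients of `θ₃ = 1 + 2q + 2q⁴ + ⋯`) and `0` otherwise.
[folklore] -/
theorem exists_coeff_qExpansion_theta3_eq {h : ℕ} (hh : 0 < h) :
    ∃ a : ℕ → ℤ, a 0 = 1 ∧ a 1 = 2 ∧
      ∀ m, (qExpansion ((h : ℝ) * 2) (fun τ : ℍ ↦ theta3 τ)).coeff m =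
        if h ∣ m then (a (m / h) : ℂ) else 0 := by
  obtain ⟨a, ha0, ha1, ha⟩ := exists_hasSum_theta3_qParam_two
  have ha' : ∀ τ : ℍ, HasSum (fun m ↦ (a m : ℂ) • Periodic.qParam 2 τ ^ m) (theta3 τ) :=
    fun τ ↦ by simpa only [smul_eq_mul] using ha τ
  exact ⟨a, ha0, ha1, fun m ↦
    qExpansion_natMul_coeff_of_hasSum hh.ne' (by ring) (by positivity) (nice_theta3 h) ha' m⟩

/-- The `q`-expansion of `θ₃` at the period `2h` has integer coefficients. [folklore] -/
theorem coeff_qExpansion_theta3_mem {h : ℕ} (hh : 0 < h) (m : ℕ) :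
    ∃ z : ℤ, (qExpansion ((h : ℝ) * 2) (fun τ : ℍ ↦ theta3 τ)).coeff m = z := by
  obtain ⟨a, -, -, ha⟩ := exists_coeff_qExpansion_theta3_eq hh
  rw [ha m]
  split_ifs
  · exact ⟨a (m / h), rfl⟩
  · exact ⟨0, by simp⟩

/-! ### Modular forms at the doubled period -/

/-- A modular form on a finite-index `Γ ≤ SL(2, ℤ)` with strict period `h` is `2h`-periodic,
holomorphic and bounded at `i∞`. [folklore] -/
theorem nice_modularForm {Γ : Subgroup SL(2, ℤ)} [Γ.FiniteIndex] {k : ℤ}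
    (f : ModularForm (Γ : Subgroup (GL (Fin 2) ℝ)) k) {h : ℕ}
    (hΓ : (h : ℝ) ∈ (Γ : Subgroup (GL (Fin 2) ℝ)).strictPeriods) :
    Periodic (⇑f ∘ ofComplex) (((h : ℝ) * 2 : ℝ) : ℂ) ∧ MDiff ⇑f ∧ IsBoundedAtImInfty ⇑f := by
  refine ⟨?_, ModularFormClass.holo f, ModularFormClass.bdd_at_infty f⟩
  have e : (((h : ℝ) * 2 : ℝ) : ℂ) = (2 : ℕ) * ((h : ℝ) : ℂ) := by push_cast; ring
  rw [e]
  exact (SlashInvariantFormClass.periodic_comp_ofComplex f hΓ).nat_mul 2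

/-- **The `q`-expansion at the period `2h` in terms of the one at the period `h`**: the `m`-th
coefficient is the `m/2`-th coefficient at period `h` for even `m` and `0` for odd `m`.
[folklore] -/
theorem coeff_qExpansion_two_mul_eq {Γ : Subgroup SL(2, ℤ)} [Γ.FiniteIndex] {k : ℤ}
    (f : ModularForm (Γ : Subgroup (GL (Fin 2) ℝ)) k) {h : ℕ} (hh : 0 < h)
    (hΓ : (h : ℝ) ∈ (Γ : Subgroup (GL (Fin 2) ℝ)).strictPeriods) (m : ℕ) :
    PowerSeries.coeff m (qExpansion ((h : ℝ) * 2) f) =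
      if 2 ∣ m then PowerSeries.coeff (m / 2) (qExpansion (h : ℝ) f) else 0 := by
  have ha : ∀ τ : ℍ, HasSum (fun m ↦ PowerSeries.coeff m (qExpansion (h : ℝ) f) •
      Periodic.qParam (h : ℝ) τ ^ m) (f τ) := fun τ ↦
    hasSum_qExpansion (Nat.cast_pos.mpr hh)
      (SlashInvariantFormClass.periodic_comp_ofComplex f hΓ) (ModularFormClass.holo f)
      (ModularFormClass.bdd_at_infty f) τ
  exact qExpansion_natMul_coeff_of_hasSum two_ne_zero (by push_cast; ring) (by positivity)
    (nice_modularForm f hΓ) ha m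

/-- If the coefficients at the period `h` lie in a subfield `K`, so do those at the period `2h`.
[folklore] -/
theorem coeff_qExpansion_two_mul_mem {Γ : Subgroup SL(2, ℤ)} [Γ.FiniteIndex] {k : ℤ}
    (f : ModularForm (Γ : Subgroup (GL (Fin 2) ℝ)) k) {h : ℕ} (hh : 0 < h)
    (hΓ : (h : ℝ) ∈ (Γ : Subgroup (GL (Fin 2) ℝ)).strictPeriods) {K : Subfield ℂ}
    (hK : ∀ m, PowerSeries.coeff m (qExpansion (h : ℝ) f) ∈ K) (m : ℕ) :
    PowerSeries.coeff m (qExpansion ((h : ℝ) * 2) f) ∈ K := by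
  rw [coeff_qExpansion_two_mul_eq f hh hΓ m]
  split_ifs
  exacts [hK _, zero_mem K]

/-! ### The theorem -/

/-- **Descent of the algebraic relation to the field of coefficients.** Let `Γ ≤ SL(2, ℤ)` have
finite index, `f` a modular form of even weight `2k` for `Γ`, `h ≥ 1` a strict period of `Γ`, and
`K ⊆ ℂ` a subfield containing every coefficient of the `q`-expansion of `f` at the period `h`.
Then `f/θ₃^{4k}` is algebraic over `K(λ)`: there are `d` and `A_0, …, A_d ∈ K[X]` (i.e. in `ℂ[X]`
with all coefficients in `K`), not all zero, with `Σ_{n ≤ d} A_n(λ(τ)) (f(τ)/θ₃(τ)^{4k})ⁿ = 0` on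
`ℍ`. [cite: CalegariDimitrovTang2025, §1 p. 3 and §3] -/
theorem exists_polynomial_relation_modularForm_of_coeff_mem {Γ : Subgroup SL(2, ℤ)}
    [Γ.FiniteIndex] (k : ℕ) (f : ModularForm (Γ : Subgroup (GL (Fin 2) ℝ)) (2 * k : ℤ))
    {h : ℕ} (hh : 0 < h) (hΓ : (h : ℝ) ∈ (Γ : Subgroup (GL (Fin 2) ℝ)).strictPeriods)
    (K : Subfield ℂ) (hK : ∀ m, PowerSeries.coeff m (qExpansion (h : ℝ) f) ∈ K) :
    ∃ (d : ℕ) (A : ℕ → ℂ[X]), (∃ n ∈ Finset.range (d + 1), A n ≠ 0) ∧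
      (∀ n i, (A n).coeff i ∈ K) ∧
      ∀ τ : ℍ, ∑ n ∈ Finset.range (d + 1),
        (A n).eval (modularLambda τ) * (f τ / theta3 τ ^ (4 * k)) ^ n = 0 := by
  classical
  obtain ⟨d, A, hd, hAd, hrel⟩ := exists_polynomial_relation_modularForm' k f
  -- a common bound for the degrees
  set N : ℕ := (Finset.range (d + 1)).sup fun n ↦ (A n).natDegree with hN
  have hdeg : ∀ n ∈ Finset.range (d + 1), (A n).natDegree < N + 1 := fun n hn ↦
    Nat.lt_succ_of_le (Finset.le_sup (f := fun n ↦ (A n).natDegree) hn)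
  -- the period `H = 2h`
  set H : ℝ := h * (2 : ℝ) with hH
  have hH0 : 0 < H := by positivity
  -- the three basic functions
  set Λ : ℍ → ℂ := fun τ ↦ modularLambda τ with hΛ
  set Θ : ℍ → ℂ := fun τ ↦ theta3 τ with hΘ
  have nΛ : Periodic (Λ ∘ ofComplex) H ∧ MDiff Λ ∧ IsBoundedAtImInfty Λ := nice_modularLambda h
  have nΘ : Periodic (Θ ∘ ofComplex) H ∧ MDiff Θ ∧ IsBoundedAtImInfty Θ := nice_theta3 h
  have nf : Periodic (⇑f ∘ ofComplex) H ∧ MDiff ⇑f ∧ IsBoundedAtImInfty ⇑f :=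
    nice_modularForm f hΓ
  -- their coefficients lie in `K`
  have cΛ : ∀ m, PowerSeries.coeff m (qExpansion H Λ) ∈ K := fun m ↦ by
    obtain ⟨z, hz⟩ := coeff_qExpansion_modularLambda_mem hh m
    rw [hz]
    exact intCast_mem K z
  have cΘ : ∀ m, PowerSeries.coeff m (qExpansion H Θ) ∈ K := fun m ↦ by
    obtain ⟨z, hz⟩ := coeff_qExpansion_theta3_mem hh m
    rw [hz]
    exact intCast_mem K z
  have cf : ∀ m, PowerSeries.coeff m (qExpansion H f) ∈ K :=
    coeff_qExpansion_two_mul_mem f hh hΓ hK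
  -- the functions `G (n, j) = λʲ θ₃^{4k(d-n)} fⁿ`
  set G : ℕ × ℕ → ℍ → ℂ := fun I ↦ Λ ^ I.2 * Θ ^ (4 * k * (d - I.1)) * (⇑f) ^ I.1 with hG
  have nG : ∀ I, Periodic (G I ∘ ofComplex) H ∧ MDiff (G I) ∧ IsBoundedAtImInfty (G I) :=
    fun I ↦ nice_mul (nice_mul (nice_pow nΛ _) (nice_pow nΘ _)) (nice_pow nf _)
  have cG : ∀ I m, PowerSeries.coeff m (qExpansion H (G I)) ∈ K := by
    intro I m
    rw [hG, qExpansion_mul_of_nice hH0 (nice_mul (nice_pow nΛ _) (nice_pow nΘ _))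
      (nice_pow nf _), qExpansion_mul_of_nice hH0 (nice_pow nΛ _) (nice_pow nΘ _),
      qExpansion_pow_of_nice hH0 nΛ, qExpansion_pow_of_nice hH0 nΘ, qExpansion_pow_of_nice hH0 nf]
    exact coeff_mul_mem (coeff_mul_mem (coeff_pow_mem cΛ _) (coeff_pow_mem cΘ _))
      (coeff_pow_mem cf _) m
  have hGapply : ∀ I (τ : ℍ), G I τ =
      modularLambda τ ^ I.2 * (theta3 τ ^ (4 * k * (d - I.1)) * f τ ^ I.1) := by
    intro I τ
    simp only [hG, hΛ, hΘ, Pi.mul_apply, Pi.pow_apply, mul_assoc]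
  -- a linear combination of the `G I` over `s` is a cleared polynomial relation
  set s : Finset (ℕ × ℕ) := Finset.range (d + 1) ×ˢ Finset.range (N + 1) with hs
  have hcomb : ∀ (cc : ℕ → ℕ → ℂ) (τ : ℍ),
      ∑ I ∈ s, cc I.1 I.2 * G I τ =
        ∑ n ∈ Finset.range (d + 1), (∑ j ∈ Finset.range (N + 1), C (cc n j) * X ^ j).eval
          (modularLambda τ) * theta3 τ ^ (4 * k * (d - n)) * f τ ^ n := by
    intro cc τ
    rw [hs, Finset.sum_product]
    refine Finset.sum_congr rfl fun n _ ↦ ?_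
    rw [eval_finsetSum, Finset.sum_mul, Finset.sum_mul]
    refine Finset.sum_congr rfl fun j _ ↦ ?_
    rw [hGapply, eval_mul, eval_C, eval_pow, eval_X]
    ring
  -- cleared and uncleared forms of a relation
  have hθ : ∀ τ : ℍ, theta3 (τ : ℂ) ≠ 0 := fun τ ↦ theta3_ne_zero τ.im_pos
  have hclear : ∀ (B : ℕ → ℂ[X]) (τ : ℍ),
      ∑ n ∈ Finset.range (d + 1), (B n).eval (modularLambda τ) *
          theta3 τ ^ (4 * k * (d - n)) * f τ ^ n =
        theta3 τ ^ (4 * k * d) * ∑ n ∈ Finset.range (d + 1),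
          (B n).eval (modularLambda τ) * (f τ / theta3 τ ^ (4 * k)) ^ n := by
    intro B τ
    rw [Finset.mul_sum]
    refine Finset.sum_congr rfl fun n hn ↦ ?_
    have hnd : n ≤ d := Nat.lt_succ_iff.mp (Finset.mem_range.mp hn)
    have hsplit : theta3 (τ : ℂ) ^ (4 * k * d) =
        theta3 (τ : ℂ) ^ (4 * k * n) * theta3 (τ : ℂ) ^ (4 * k * (d - n)) := by
      rw [← pow_add, ← mul_add, Nat.add_sub_cancel' hnd]
    have hθτ := hθ τ
    rw [div_pow, ← pow_mul, hsplit]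
    field_simp
  -- the vectors of `q`-coefficients, with entries in `K`, and the complex coefficients
  set v : ↥s → ℕ → K := fun I m ↦ ⟨_, cG I m⟩ with hv
  have hsumG : ∀ (I : ↥s) (τ : ℍ),
      HasSum (fun m ↦ ((v I m : K) : ℂ) * Periodic.qParam H τ ^ m) (G I τ) := fun I τ ↦ by
    simpa only [hv, smul_eq_mul] using hasSum_qExpansion hH0 (nG I).1 (nG I).2.1 (nG I).2.2 τ
  set c : ↥s → ℂ := fun I ↦ (A I.1.1).coeff I.1.2 with hc
  -- `c ≠ 0`: the leading coefficient of `A d ≠ 0`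
  have hAd0 : A d ≠ 0 := by
    rw [hAd]
    exact pow_ne_zero _ (mul_ne_zero X_ne_zero (by
      rw [sub_ne_zero]; exact fun h1 ↦ by simpa using congrArg (Polynomial.eval 0) h1))
  have hdmem : (d, (A d).natDegree) ∈ s := by
    rw [hs, Finset.mem_product]
    exact ⟨Finset.self_mem_range_succ d,
      Finset.mem_range.mpr (hdeg d (Finset.self_mem_range_succ d))⟩
  have hc0 : c ≠ 0 := by
    intro h0
    have := congr_fun h0 ⟨(d, (A d).natDegree), hdmem⟩
    simp only [hc, Pi.zero_apply, coeff_natDegree, leadingCoeff_eq_zero] at this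
    exact hAd0 this
  -- the complex relation `Σ c_I G_I = 0`
  have hGsum0 : ∀ τ : ℍ, ∑ I : ↥s, c I * G I τ = 0 := by
    intro τ
    set g : ℕ × ℕ → ℂ := fun J ↦ (A J.1).coeff J.2 * G J τ with hg
    rw [show ∑ I : ↥s, c I * G I τ = ∑ I : ↥s, g I from rfl, Finset.sum_coe_sort s g, hg,
      hcomb (fun n j ↦ (A n).coeff j) τ]
    rw [← hrel τ]
    refine Finset.sum_congr rfl fun n hn ↦ ?_
    rw [eval_eq_sum_range' (hdeg n hn), eval_finsetSum]
    simp only [eval_mul, eval_C, eval_pow, eval_X]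
  -- hence all coefficients of `Σ c_I · qExpansion (G I)` vanish
  have han0 : AnalyticAt ℂ (cuspFunction H (0 : ℍ → ℂ)) 0 :=
    analyticAt_cuspFunction_zero hH0 (fun _ ↦ rfl) mdifferentiable_const
      (Filter.const_boundedAtFilter _ _)
  have hcoef : ∀ m, ∑ I : ↥s, c I * ((v I m : K) : ℂ) = 0 := by
    intro m
    have hsum : ∀ τ : ℍ, HasSum (fun m ↦ (∑ I : ↥s, c I * ((v I m : K) : ℂ)) •
        Periodic.qParam H τ ^ m) ((0 : ℍ → ℂ) τ) := by
      intro τ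
      have h1 := hasSum_sum fun (I : ↥s) (_ : I ∈ Finset.univ) ↦ (hsumG I τ).mul_left (c I)
      rw [hGsum0 τ] at h1
      simp only [← mul_assoc, ← Finset.sum_mul] at h1
      simp only [smul_eq_mul, Pi.zero_apply]
      exact h1
    have h2 := qExpansion_coeff_eq_of_hasSum hH0 han0 hsum m
    rwa [qExpansion_zero, map_zero, eq_comm] at h2
  have hcoef' : ∀ m, ∑ I : ↥s, c I * algebraMap K ℂ (v I m) = 0 := fun m ↦ hcoef m
  -- DESCENT of the linear relation to `K`
  obtain ⟨c', hc'0, hrel'⟩ :=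
    Literature.LinearAlgebra.BaseChange.exists_ne_zero_linearRelation_of_algebraMap hc0 hcoef'
  -- the descended polynomials
  set cc : ℕ → ℕ → ℂ := fun n j ↦ if hI : (n, j) ∈ s then ((c' ⟨(n, j), hI⟩ : K) : ℂ) else 0
    with hcc
  have hccK : ∀ n j, cc n j ∈ K := by
    intro n j
    simp only [hcc]
    split_ifs
    exacts [SetLike.coe_mem _, zero_mem K]
  set A' : ℕ → ℂ[X] := fun n ↦ ∑ j ∈ Finset.range (N + 1), C (cc n j) * X ^ j with hA'
  have hA'coeff : ∀ n i, (A' n).coeff i = if i ∈ Finset.range (N + 1) then cc n i else 0 := by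
    intro n i
    simp only [hA', finsetSum_coeff, coeff_C_mul_X_pow]
    rw [Finset.sum_ite_eq]
  refine ⟨d, A', ?_, fun n i ↦ ?_, fun τ ↦ ?_⟩
  · -- not all zero
    obtain ⟨⟨⟨n, j⟩, hI⟩, hne⟩ := Function.ne_iff.mp hc'0
    have hI' := hI
    rw [hs, Finset.mem_product] at hI'
    refine ⟨n, hI'.1, fun h0 ↦ hne ?_⟩
    have h1 := congrArg (fun P : ℂ[X] ↦ P.coeff j) h0
    simp only [hA'coeff, coeff_zero, if_pos hI'.2, hcc, dif_pos hI] at h1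
    rw [Pi.zero_apply]
    exact_mod_cast h1
  · -- coefficients in `K`
    rw [hA'coeff]
    split_ifs
    exacts [hccK n i, zero_mem K]
  · -- the relation
    have hsum0 : ∑ I : ↥s, ((c' I : K) : ℂ) * G I τ = 0 := by
      have h1 := hasSum_sum fun (I : ↥s) (_ : I ∈ Finset.univ) ↦
        (hsumG I τ).mul_left ((c' I : K) : ℂ)
      simp only [← mul_assoc, ← Finset.sum_mul] at h1
      have h2 : ∀ m, ∑ I : ↥s, ((c' I : K) : ℂ) * ((v I m : K) : ℂ) = 0 := fun m ↦ by
        exact_mod_cast hrel' m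
      simp only [h2, zero_mul] at h1
      exact h1.unique hasSum_zero
    have hsum1 : ∑ I : ↥s, ((c' I : K) : ℂ) * G I τ = ∑ I ∈ s, cc I.1 I.2 * G I τ := by
      rw [← Finset.sum_coe_sort s (fun J ↦ cc J.1 J.2 * G J τ)]
      refine Finset.sum_congr rfl fun I _ ↦ ?_
      simp only [hcc, dif_pos I.2]
    rw [hsum1, hcomb cc τ, hclear A' τ, mul_eq_zero] at hsum0
    exact hsum0.resolve_left (pow_ne_zero _ (hθ τ))

end ModularLambda

end Literature.NumberTheory.Automorphic

end
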